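import Summits.BirchSwinnertonDyer.BirchSwinnertonDyer.Theorems.PrintX10bBeyondCarrierOfEnvelopeAndMuLe
import Summits.BirchSwinnertonDyer.BirchSwinnertonDyer.Theorems.PrintX10bBeyondCarrierEnvelopeOfCoherentPair
import HarnessLib

/-!
# Crux `BeyondCarrierDepthX10b` (stmt-BirchSwinnertonDyer-23055, PrintX10b aside r301), line «twins», skeleton
# v6.2: the crux BY NAME from the μ-INEQUALITY IN THE STABILISED CURRENCY
# `μ_(p)(X_tors) ≤ 2 · μ_(p)(𝔖/Λκ_∞(C))` — modulo eleven cite-only facts (census theorem)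

HONEST FRAMING (cell `run/shared/lean/pub/bsd-print-x9/`, seat bsd-line-x10b-p1-w2 g3 under the LEAD of the
registered line on crux 23055, D-0154 KEY row 10): THEOREMS ONLY, conditional glue `--supports 23055`; nothing
booked, nothing closed. «beyond-print theorem»: NO. BSD is not proved by any of this; no summit statement is
proved by this seat.

WHY. The sharp census `PrintX10bBeyondCarrierOfEnvelopeAndMuLe` (p615134) closes the crux from the envelope
`s_env` — since landed modulo print (`stub_envelope_divisibleClassNumber_of_coherentPair`, p621917) — and the
μ-inequality `hμle` stated in the TIED currency, i.e. for EVERY Howard family `F` with `F.Dt = Dt`: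
`length_(p)(X_tors) ≤ 2 · length_(p)(𝔖/ℋ_∞(F))`.  The port road for the μ-part (Howard's Eisenstein-prime
specialisation `q_m = T^m + p` with the loss-free DVR bound, idea `specialise-first-mu-x10b`; FINDING of
x9-p1-w2 g3, 2026-08-28T10:02Z, on the X9 twin 27077) delivers the inequality in the STABILISED currency of
CGLS 2022 only — for every `d(k)`-shifted stabilised datum `C`: `length_(p)(X_tors) ≤ 2 · length_(p)(𝔖/Λκ_∞(C))`,
class-number-free, with no family `F` and no tie to `Dt` — and passing from `C` to an ARBITRARY tied `F` would
need `ℋ_∞(F) ≤ Λκ_∞(C)`, which the tree proves only for the envelope engine's own coherent family.  But the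
composition never needs an arbitrary `F`: it needs ONE tied family.  This file re-runs the divisible half with
the μ-step performed in the `C`-currency and the passage to the tie done LAST, through the coherent pair
`(C₀, F₀)` of `exists_coherent_pair_envelope` (`ℋ_∞(F₀) ≤ Λκ_∞(C₀)` as MODULES, `F₀.Dt = Dt`):
`(p^m)·I(Λκ_∞(C₀))² ⊆ char_Λ(X_tors)` (CGLS Thm. 4.1.3) and `hμC` promote (p613811) to
`I(Λκ_∞(C₀))² ⊆ char_Λ(X_tors)`, and `I(ℋ_∞(F₀)) ⊆ I(Λκ_∞(C₀))` (char-ideal monotonicity, `𝔖/ℋ_∞(F₀)` torsion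
by Thm. 4.1.1 transported along the reverse envelope) gives the tied containment `I(ℋ_∞(F₀))² ⊆ char_Λ(X_tors)`
that the pinned transfer consumes.  CENSUS after this file (numbers): crux 23055 BY NAME ⟸ ONE open statement
`hμC` (the stabilised μ-inequality on the rank-one `3 ∣ h_K` X10b frames; research, beyond print, exactly the
output form of the port road) + 11 cite-only facts (`h46` for `3 ∤ h_K`; `hNV`, `hCGLS`, `hTw` for `3 ∣ h_K`;
`h57 h59gp h422 h513 hC` transfer; `h331`; `hChaL`, `hKo` glue).

WHAT.
* `upperLinkX10b_divisibleClassNumber_of_muStabilized_of_printFacts (hNV hCGLS hTw h57 h59gp h422 h513 hC h331)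
  (hμC)` — U₃ on the `3 ∣ h_K` X10b frames.
* `beyondCarrierDepthX10b_of_muStabilized_of_namedFacts (h46 hNV hCGLS hTw h57 h59gp h422 h513 hC h331 hChaL hKo)
  (hμC) : BeyondCarrierDepthX10b`.

References: [CastellaGrossiLeeSkinner2022] Thm. 4.1.1, Rem. 4.1.4, Thm. 4.1.3, Cor. 3.4.2; [Howard2004HeegnerKolyvagin]
Thm. 2.2.10 (proof: `𝔮 = T^m + p`), §3.3; [MastellaZerman2026] Cor. 4.6, Thm. 2.40; [YanZhu2024MainConjNonCM]
Thm. 5.7 (1), 5.9; [BurungaleCastellaSkinner2025] Prop. 4.2.2; [JetchevSkinnerWan2017] Thm. 3.3.1; [Cha2005]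
Rmk. 25; [Kolyvagin1990] Thm. A; [Washington1997] §13.2; skeleton v6.2 `Cruxes/BeyondCarrierDepthX10b/Lines/twins.lean`;
companion `PrintX10bBeyondCarrierOfEnvelopeAndMuLe.lean`.
-/

-- the REGISTERED stub namespace `Summit.BirchSwinnertonDyer.BirchSwinnertonDyer.Cruxes.…` repeats the summit name
set_option linter.dupNamespace false
set_option autoImplicit false

noncomputable section

open scoped Classical Pointwise

open WeierstrassCurve NumberField IsDedekindDomain Field Literature.NumberTheory.EllipticCurves
  Literature.NumberTheory.EllipticCurves.ModularForms Literature.NumberTheory.EllipticCurves.Rank1Residual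
  Literature.NumberTheory.EllipticCurves.Castella2018 Literature.NumberTheory.EllipticCurves.YanZhu2026
  Literature.NumberTheory.EllipticCurves.CastellaGrossiLeeSkinner2022
  Literature.NumberTheory.EllipticCurves.JetchevSkinnerWan2017

open Summit.BirchSwinnertonDyer.Rank1Residual
open Summit.BirchSwinnertonDyer.BirchSwinnertonDyer.Rank1Residual (X10.thm413Hypotheses_of_classX10)
open Summit.BirchSwinnertonDyer.BirchSwinnertonDyer.Cruxes.TwoSidedLinkAnyClassNumberX10b.CompositeTransferX10b
  (imcWaldspurgerOnTreeGoodAt_inducedPlace_of_printFacts_of_pinnedTransfer)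
open Summit.BirchSwinnertonDyer.BirchSwinnertonDyer.Cruxes.BeyondCarrierDepthX10b.UpperHalf
  (upperLink_of_imcWaldspurgerOnTreeGoodAt upperLinkX10b_coprimeClassNumber_of_pinnedPrintFacts)
open Summit.BirchSwinnertonDyer.BirchSwinnertonDyer.Theses.PrintX10b (BeyondCarrierDepthX10b)

namespace Summit.BirchSwinnertonDyer.BirchSwinnertonDyer.Cruxes.BeyondCarrierDepthX10b.HowardFrames

/-- **U₃ on the `3 ∣ h_K` X10b frames from the μ-INEQUALITY IN THE STABILISED CURRENCY `hμC`, modulo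
nine print facts** (`hNV` CGLS Thm. 4.1.1: `𝔖/Λκ_∞(C)` torsion; `hCGLS` CGLS Thm. 4.1.3 localized; `hTw` the tower
clause `K_k ⊆ K[p^{k+1}]`; `h57 h59gp h422 h513 hC h331` the pinned class-number-free transfer inputs).  Chain:
`jbar := IsAlgClosed.lift` along `ιC`; data `D`, `X` by the tree's existence theorems; the COHERENT PAIR
`(C, F)` on `Dt` with `ℋ_∞(F) ≤ Λκ_∞(C)` and `g • Λκ_∞(C) ≤ ℋ_∞(F)`, `g ≠ 0` (`exists_coherent_pair_envelope`);
torsion of `𝔖/Λκ_∞(C)` (Thm. 4.1.1) and of `𝔖/ℋ_∞(F)` (reverse envelope); CGLS Thm. 4.1.3 at `(D, C, X)`: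
`𝔖`, `X.X` f.g. and `(p^m)·I(Λκ_∞(C))² ⊆ char_Λ(X_tors)`; promotion by `hμC` (p613811) IN THE `C`-CURRENCY:
`I(Λκ_∞(C))² ⊆ char_Λ(X_tors)`; forward envelope: `I(ℋ_∞(F)) ⊆ I(Λκ_∞(C))`, hence the TIED containment
`I(ℋ_∞(F))² ⊆ char_Λ(X_tors)`; pinned transfer; `≤` half.
[cite: CastellaGrossiLeeSkinner2022, Thm. 4.1.1, Rem. 4.1.4, Thm. 4.1.3 and Cor. 3.4.2] [cite: Washington1997, §13.2]
[cite: Howard2004HeegnerKolyvagin, Thm. 2.2.10 (proof) and §3.3] [cite: YanZhu2024MainConjNonCM, Thm. 5.7 (1) and Thm. 5.9]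
[cite: BurungaleCastellaSkinner2025, Prop. 4.2.2] [cite: JetchevSkinnerWan2017, Thm. 3.3.1]
[cite: Castella2018, §5 (eq:IMC+BDP)] -/
theorem upperLinkX10b_divisibleClassNumber_of_muStabilized_of_printFacts
    (hNV : thm411_torsionFree_heegnerClass_ne_bot_quotient_isTorsion.{0})
    (hCGLS : thm413_rankOne_charIdeal_torsion_dvd_localized.{0})
    (hTw : ∀ (K : Type) [Field K] [NumberField K] (p : ℕ) [Fact p.Prime], Odd p →
      Literature.NumberTheory.EllipticCurves.IsImaginaryQuadratic K →
      ∀ (κ : Literature.NumberTheory.EllipticCurves.ZpExtension K p), κ.IsAnticyclotomic →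
      ∀ (jbar : AlgebraicClosure K →+* ℂ) (k : ℕ),
      Literature.NumberTheory.EllipticCurves.ringClassSubgroup K (p ^ (k + 1)) jbar ≤ κ.layerSubgroup k)
    (h57 : thm57_isTorsion_charIdealXGr_eq_bdpLFunction)
    (h59gp : ∀ {p : ℕ} [Fact p.Prime] (ι' : PadicAlgCl p ≃+* ℂ) (W : WeierstrassCurve ℚ) [W.IsElliptic]
      [W.IsGloballyMinimal] (K : Type) [Field K] [NumberField K] (v vbar : HeightOneSpectrum (𝓞 K))
      (κ : ZpExtension K p) (γ : absoluteGaloisGroup K) [Fact (κ.IsTopGenerator γ)] {N : ℕ} [NeZero N]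
      {f : CuspForm (CongruenceSubgroup.Gamma0 N) 2} (jbar : AlgebraicClosure K →+* ℂ)
      (_ : IsNewformOf W f),
      N = W.conductorNorm ℤ → 3 ≤ p → GoodOrd W p → (W.baseChange K).HasIrreducibleModPGaloisRep p →
      IsImaginaryQuadratic K → SatisfiesHeegnerHypothesis N K →
        ((Ideal.span {(p : ℤ)}).primesOver (𝓞 K)).ncard = 2 →
        Odd (NumberField.discr K) → NumberField.discr K ≠ -3 → κ.IsAnticyclotomic →
      (∀ (w : InfinitePlace K) (k : 𝓞 K), k ∈ v.asIdeal ↔ ‖ι'.symm (w.embedding (k : K))‖ < 1) →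
        ((p : ℕ) : 𝓞 K) ∈ vbar.asIdeal → vbar ≠ v →
      ∃ (ΩK : ℂ) (Ωp : (unrIntegers p)ˣ) (L : UnrSeries p),
        ΩK ≠ 0 ∧ IsBDPLFunction ι' v κ γ f ΩK ((Ωp : unrIntegers p) : ℂ_[p]) L ∧
        ∀ (D : (W.baseChange K).LambdaAdicSelmerData κ γ) (F : HeegnerFamily N W K κ jbar)
          (X : (W.baseChange K).SelmerDualData κ γ) (j : ℤ_[p] →+* unrIntegers p),
          ¬ (p : ℤ) ∣ F.Dt.c →
          (∀ x : ℤ_[p], ((j x : unrIntegers p) : ℂ_[p]) = algebraMap ℚ_[p] ℂ_[p] (x : ℚ_[p])) →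
          heegnerCharIdeal D F ^ 2 ≤
              Module.charIdeal (IwasawaAlgebra p) (Submodule.torsion (IwasawaAlgebra p) X.X) →
            L ∈ (AcSelmer.XAc.charIdeal (W.baseChange K) p κ vbar ∅ γ).map (PowerSeries.map j))
    (h422 : BurungaleCastellaSkinner2025.prop422_exists_isBDPLFunction_mu_eq_zero)
    (h513 : thm513_exists_isBDPLFunction_valueAtOne_disc)
    (hC : ∀ (N : ℕ) [NeZero N], IsNewformOf.level_eq_conductorNorm (N := N))
    (h331 : thm331_anticyclotomicControl)
    (hμC : ∀ (W : WeierstrassCurve ℚ) [W.IsElliptic] [W.IsGloballyMinimal] (p : ℕ) [Fact p.Prime]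
      [NeZero (W.conductorNorm ℤ)] (K : Type) [Field K] [NumberField K],
      Literature.NumberTheory.EllipticCurves.Rank1Residual.ClassX10 W p →
      ¬ Literature.NumberTheory.EllipticCurves.Rank1Residual.Surj W 3 → ¬ W.HasCM →
      Literature.NumberTheory.EllipticCurves.IsImaginaryQuadratic K → Odd (NumberField.discr K) →
      NumberField.discr K ≠ -3 →
      Literature.NumberTheory.EllipticCurves.SatisfiesHeegnerHypothesis (W.conductorNorm ℤ) K →
      Literature.NumberTheory.EllipticCurves.SatisfiesHeegnerHypothesis p K →
      p ∣ NumberField.classNumber K →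
      (W.baseChange K).HasIrreducibleModPGaloisRep p →
      ∀ (κ : Literature.NumberTheory.EllipticCurves.ZpExtension K p), κ.IsAnticyclotomic →
      ∀ (γ : Field.absoluteGaloisGroup K), κ.IsTopGenerator γ →
      ∀ (jbar : AlgebraicClosure K →+* ℂ),
      (W.baseChange K).mordellWeilRank = 1 →
      Finite (AddCommGroup.primaryComponent (W.baseChange K).sha p) →
      ∀ (D : (W.baseChange K).LambdaAdicSelmerData κ γ)
        (C : Literature.NumberTheory.EllipticCurves.CastellaGrossiLeeSkinner2022.StabilizedHeegnerData
          (W.conductorNorm ℤ) W K κ jbar)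
        (X : (W.baseChange K).SelmerDualData κ γ),
        Module.Finite (Literature.NumberTheory.EllipticCurves.IwasawaAlgebra p) D.S →
        Module.Finite (Literature.NumberTheory.EllipticCurves.IwasawaAlgebra p) X.X →
        Module.IsTorsion (Literature.NumberTheory.EllipticCurves.IwasawaAlgebra p)
          (D.S ⧸ Literature.NumberTheory.EllipticCurves.CastellaGrossiLeeSkinner2022.stabilizedHeegnerModule
            D C) →
      ∀ 𝔭 : PrimeSpectrum (Literature.NumberTheory.EllipticCurves.IwasawaAlgebra p),
        𝔭.asIdeal = Ideal.span {(p : Literature.NumberTheory.EllipticCurves.IwasawaAlgebra p)} →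
        Module.lengthAt (Literature.NumberTheory.EllipticCurves.IwasawaAlgebra p)
          (Submodule.torsion (Literature.NumberTheory.EllipticCurves.IwasawaAlgebra p) X.X) 𝔭 ≤
        2 * Module.lengthAt (Literature.NumberTheory.EllipticCurves.IwasawaAlgebra p)
          (D.S ⧸ Literature.NumberTheory.EllipticCurves.CastellaGrossiLeeSkinner2022.stabilizedHeegnerModule
            D C) 𝔭) :
    ∀ (W : WeierstrassCurve ℚ) [W.IsElliptic] [W.IsGloballyMinimal] (p : ℕ) [Fact p.Prime]
    [NeZero (W.conductorNorm ℤ)] (K : Type) [Field K] [NumberField K],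
    Literature.NumberTheory.EllipticCurves.Rank1Residual.ClassX10 W p →
    ¬ Literature.NumberTheory.EllipticCurves.Rank1Residual.Surj W 3 → ¬ W.HasCM →
    Literature.NumberTheory.EllipticCurves.IsImaginaryQuadratic K → Odd (NumberField.discr K) →
    NumberField.discr K ≠ -3 →
    Literature.NumberTheory.EllipticCurves.SatisfiesHeegnerHypothesis (W.conductorNorm ℤ) K →
    Literature.NumberTheory.EllipticCurves.SatisfiesHeegnerHypothesis p K →
    p ∣ NumberField.classNumber K →
    (W.baseChange K).HasIrreducibleModPGaloisRep p →
    ∀ (ι : K →+* ℚ_[p]) (κ : Literature.NumberTheory.EllipticCurves.ZpExtension K p), κ.IsAnticyclotomic →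
    ∀ (γ : Field.absoluteGaloisGroup K) [Fact (κ.IsTopGenerator γ)]
    (Dt : Literature.NumberTheory.EllipticCurves.ModularForms.ModularParametrizationData W
    (W.conductorNorm ℤ)), ¬ (p : ℤ) ∣ Dt.c →
    ∀ (H : Literature.NumberTheory.EllipticCurves.HeegnerDatum (W.conductorNorm ℤ) (NumberField.discr K))
    (ιC : K →+* ℂ) (P : (W.baseChange K).toAffine.Point),
    WeierstrassCurve.Affine.Point.map ιC.toRatAlgHom P =
    Literature.NumberTheory.EllipticCurves.ModularForms.heegnerPointComplex Dt H →
    (W.baseChange K).mordellWeilRank = 1 →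
    Finite (AddCommGroup.primaryComponent (W.baseChange K).sha p) → ¬ IsOfFinAddOrder P →
    ∃ n : ℕ, Summit.BirchSwinnertonDyer.Rank1Residual.X11b.AcSelmer.XAc.HasCharValuationAt
    (W.baseChange K) p κ (Summit.BirchSwinnertonDyer.Rank1Residual.X11b.inducedPlace ι) ∅ γ n ∧
    (n : ℤ) ≤ 2 * (Summit.BirchSwinnertonDyer.Rank1Residual.X11b.padicLogOrd W p ι P +
    (padicValInt p (1 - W.frobeniusTrace p + p) : ℤ) - 1) := by
  intro W _ _ p _ _ K _ _ hX hns hcm hK hodd h3 hHN hHp hhK hirr ι κ hκ γ _ Dt hc H ιC P hP hrk hfin hPinf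
  have hγ : κ.IsTopGenerator γ := Fact.out
  have hp : p.Prime := Fact.out
  have hp_odd : Odd p := hp.odd_of_ne_two hX.ne_two
  -- an embedding `K̄ → ℂ` over `ιC` for the tied family
  letI : Algebra K ℂ := ιC.toAlgebra
  let jbar : AlgebraicClosure K →+* ℂ :=
    (IsAlgClosed.lift (R := K) (M := ℂ) (S := AlgebraicClosure K)).toRingHom
  -- the data exist (tree theorems)
  obtain ⟨D⟩ := WeierstrassCurve.LambdaAdicSelmerDataExists.nonempty_lambdaAdicSelmerData (W.baseChange K) p κ hγ
  obtain ⟨X⟩ := (W.baseChange K).nonempty_selmerDualData_holds κ γ hγ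
  have hyp := X10.thm413Hypotheses_of_classX10 hX hK h3 hHN hHp hodd hκ hγ
  -- the coherent pair `(C, F)` on `Dt` with its two MODULE inclusions (x9-p2's envelope engine)
  obtain ⟨C, F, -, hFDt, -, -, hfwd, g, hg, hrev⟩ := exists_coherent_pair_envelope hK hHN Dt H.dvd_sq_sub jbar
    hyp.ordinary (ClassX10.not_dvd_conductorNorm hX) κ hγ (fun k ↦ hTw K p hp_odd hK κ hκ jbar k)
    (card_ringClassGalOver_prime_one_of_frame hK hodd h3 hp hHp jbar) hyp.noPTorsion D
  -- `𝔖/Λκ_∞(C)` torsion (Thm. 4.1.1), transported to `𝔖/ℋ_∞(F)` along the reverse envelope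
  have htorC : Module.IsTorsion (IwasawaAlgebra p) (D.S ⧸ stabilizedHeegnerModule D C) :=
    isTorsion_quotient_stabilizedHeegnerModule_of_thm411 hNV hyp D C
  have htorF : Module.IsTorsion (IwasawaAlgebra p) (D.S ⧸ heegnerModule D F) :=
    isTorsion_quotient_heegnerModule_of_smul_stabilizedHeegnerModule_le D F C hg hrev htorC
  -- CGLS Thm. 4.1.3 at `(D, C, X)`
  obtain ⟨⟨hfinS, -⟩, hfinX, -⟩ := hCGLS (W.conductorNorm ℤ) W K p κ γ jbar hyp D C X
  obtain ⟨m, hm⟩ := span_pow_mul_sq_le_charIdeal_torsion_of_thm413 hCGLS hyp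
    (X9.selmerCorank_eq_one_of_rank_one hrk hfin) D C X
  haveI := hfinX
  haveI := hfinS
  haveI : IsNoetherian (IwasawaAlgebra p) X.X := isNoetherian_of_isNoetherianRing_of_finite _ _
  haveI : Module.Finite (IwasawaAlgebra p) (Submodule.torsion (IwasawaAlgebra p) X.X) := inferInstance
  haveI : Module.Finite (IwasawaAlgebra p) (D.S ⧸ stabilizedHeegnerModule D C) := inferInstance
  -- the μ-part IN THE STABILISED CURRENCY: promotion by `hμC` at `(D, C, X)`
  have hleC : stabilizedHeegnerCharIdeal D C ^ 2 ≤
      Module.charIdeal (IwasawaAlgebra p) (Submodule.torsion (IwasawaAlgebra p) X.X) :=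
    IwasawaAlgebra.sq_charIdeal_le_charIdeal_of_span_p_pow_mul_le_of_lengthAt_le_two_mul
      (Submodule.torsion_isTorsion (R := IwasawaAlgebra p) (M := X.X)) htorC
      (hμC W p K hX hns hcm hK hodd h3 hHN hHp hhK hirr κ hκ γ hγ jbar hrk hfin D C X hfinS hfinX htorC) hm
  -- the forward envelope LAST: `I(ℋ_∞(F)) ⊆ I(Λκ_∞(C))`, so the TIED containment holds for `F`
  have hle : heegnerCharIdeal D F ^ 2 ≤
      Module.charIdeal (IwasawaAlgebra p) (Submodule.torsion (IwasawaAlgebra p) X.X) :=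
    (Ideal.pow_right_mono (heegnerCharIdeal_le_stabilizedHeegnerCharIdeal_of_le D F C htorF hfwd) 2).trans hleC
  -- the pinned class-number-free transfer, then the `≤` half
  obtain ⟨hp3, hord, -, -⟩ := id hX
  subst hp3
  exact upperLink_of_imcWaldspurgerOnTreeGoodAt
    (imcWaldspurgerOnTreeGoodAt_inducedPlace_of_printFacts_of_pinnedTransfer h57 h59gp h422 h513 hC h331
      le_rfl hord hK hodd h3 rfl hHN hHp hirr ι κ hκ γ Dt hc H ιC P hP hrk hfin hPinf ⟨jbar, D, F, X, hFDt, hle⟩)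

/-- **The crux `BeyondCarrierDepthX10b` (stmt-23055) BY NAME from ONE open statement — the μ-INEQUALITY IN
THE STABILISED CURRENCY `hμC` (`length_(p)(X_tors) ≤ 2 · length_(p)(𝔖/Λκ_∞(C))` for every `d(k)`-shifted
stabilised datum `C` on the rank-one `3 ∣ h_K` X10b frames; the output form of Howard's `q_m = T^m + p`
specialisation road, beyond print) — modulo eleven cite-only facts (CENSUS theorem).**  Coprime half:
x10b-p1-w2's pinned road (`upperLinkX10b_coprimeClassNumber_of_pinnedPrintFacts`, p609477: `h46` MZ26 Cor. 4.6
tied + the pinned transfer); divisible half: the theorem above; glue: `stub_beyondCarrier_of_upperLink_of_namedFacts`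
(`h331 hChaL hKo`, p609388/p607624).  Numbers: 1 open statement; 11 facts, of which `h46` serves only the
`3 ∤ h_K` frames and `hNV`, `hCGLS`, `hTw` only the `3 ∣ h_K` frames. [cite: MastellaZerman2026, Cor. 4.6]
[cite: CastellaGrossiLeeSkinner2022, Thm. 4.1.1, Thm. 4.1.3 and Thm. 5.1.3] [cite: Howard2004HeegnerKolyvagin, Thm. 2.2.10 (proof)]
[cite: YanZhu2024MainConjNonCM, Thm. 5.7 (1), 5.9] [cite: BurungaleCastellaSkinner2025, Prop. 4.2.2]
[cite: JetchevSkinnerWan2017, Thm. 3.3.1] [cite: Cha2005, Rmk. 25] [cite: Kolyvagin1990, Thm. A]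
[cite: Washington1997, §13.2] -/
theorem beyondCarrierDepthX10b_of_muStabilized_of_namedFacts
    (h46 : MastellaZerman2026.cor46_howardDivisibility_of_scalarImage.{0})
    (hNV : thm411_torsionFree_heegnerClass_ne_bot_quotient_isTorsion.{0})
    (hCGLS : thm413_rankOne_charIdeal_torsion_dvd_localized.{0})
    (hTw : ∀ (K : Type) [Field K] [NumberField K] (p : ℕ) [Fact p.Prime], Odd p →
      Literature.NumberTheory.EllipticCurves.IsImaginaryQuadratic K →
      ∀ (κ : Literature.NumberTheory.EllipticCurves.ZpExtension K p), κ.IsAnticyclotomic →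
      ∀ (jbar : AlgebraicClosure K →+* ℂ) (k : ℕ),
      Literature.NumberTheory.EllipticCurves.ringClassSubgroup K (p ^ (k + 1)) jbar ≤ κ.layerSubgroup k)
    (h57 : thm57_isTorsion_charIdealXGr_eq_bdpLFunction)
    (h59gp : ∀ {p : ℕ} [Fact p.Prime] (ι' : PadicAlgCl p ≃+* ℂ) (W : WeierstrassCurve ℚ) [W.IsElliptic]
      [W.IsGloballyMinimal] (K : Type) [Field K] [NumberField K] (v vbar : HeightOneSpectrum (𝓞 K))
      (κ : ZpExtension K p) (γ : absoluteGaloisGroup K) [Fact (κ.IsTopGenerator γ)] {N : ℕ} [NeZero N]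
      {f : CuspForm (CongruenceSubgroup.Gamma0 N) 2} (jbar : AlgebraicClosure K →+* ℂ)
      (_ : IsNewformOf W f),
      N = W.conductorNorm ℤ → 3 ≤ p → GoodOrd W p → (W.baseChange K).HasIrreducibleModPGaloisRep p →
      IsImaginaryQuadratic K → SatisfiesHeegnerHypothesis N K →
        ((Ideal.span {(p : ℤ)}).primesOver (𝓞 K)).ncard = 2 →
        Odd (NumberField.discr K) → NumberField.discr K ≠ -3 → κ.IsAnticyclotomic →
      (∀ (w : InfinitePlace K) (k : 𝓞 K), k ∈ v.asIdeal ↔ ‖ι'.symm (w.embedding (k : K))‖ < 1) →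
        ((p : ℕ) : 𝓞 K) ∈ vbar.asIdeal → vbar ≠ v →
      ∃ (ΩK : ℂ) (Ωp : (unrIntegers p)ˣ) (L : UnrSeries p),
        ΩK ≠ 0 ∧ IsBDPLFunction ι' v κ γ f ΩK ((Ωp : unrIntegers p) : ℂ_[p]) L ∧
        ∀ (D : (W.baseChange K).LambdaAdicSelmerData κ γ) (F : HeegnerFamily N W K κ jbar)
          (X : (W.baseChange K).SelmerDualData κ γ) (j : ℤ_[p] →+* unrIntegers p),
          ¬ (p : ℤ) ∣ F.Dt.c →
          (∀ x : ℤ_[p], ((j x : unrIntegers p) : ℂ_[p]) = algebraMap ℚ_[p] ℂ_[p] (x : ℚ_[p])) →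
          heegnerCharIdeal D F ^ 2 ≤
              Module.charIdeal (IwasawaAlgebra p) (Submodule.torsion (IwasawaAlgebra p) X.X) →
            L ∈ (AcSelmer.XAc.charIdeal (W.baseChange K) p κ vbar ∅ γ).map (PowerSeries.map j))
    (h422 : BurungaleCastellaSkinner2025.prop422_exists_isBDPLFunction_mu_eq_zero)
    (h513 : thm513_exists_isBDPLFunction_valueAtOne_disc)
    (hC : ∀ (N : ℕ) [NeZero N], IsNewformOf.level_eq_conductorNorm (N := N))
    (h331 : thm331_anticyclotomicControl)
    (hChaL : Cha2005.rmk25_pow_dvd_card_sha_primary_of_certificate)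
    (hKo : ∀ (N : ℕ) [NeZero N] (W : WeierstrassCurve ℚ) (K : Type) [Field K] [NumberField K],
      kolyvagin N W K)
    (hμC : ∀ (W : WeierstrassCurve ℚ) [W.IsElliptic] [W.IsGloballyMinimal] (p : ℕ) [Fact p.Prime]
      [NeZero (W.conductorNorm ℤ)] (K : Type) [Field K] [NumberField K],
      Literature.NumberTheory.EllipticCurves.Rank1Residual.ClassX10 W p →
      ¬ Literature.NumberTheory.EllipticCurves.Rank1Residual.Surj W 3 → ¬ W.HasCM →
      Literature.NumberTheory.EllipticCurves.IsImaginaryQuadratic K → Odd (NumberField.discr K) →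
      NumberField.discr K ≠ -3 →
      Literature.NumberTheory.EllipticCurves.SatisfiesHeegnerHypothesis (W.conductorNorm ℤ) K →
      Literature.NumberTheory.EllipticCurves.SatisfiesHeegnerHypothesis p K →
      p ∣ NumberField.classNumber K →
      (W.baseChange K).HasIrreducibleModPGaloisRep p →
      ∀ (κ : Literature.NumberTheory.EllipticCurves.ZpExtension K p), κ.IsAnticyclotomic →
      ∀ (γ : Field.absoluteGaloisGroup K), κ.IsTopGenerator γ →
      ∀ (jbar : AlgebraicClosure K →+* ℂ),
      (W.baseChange K).mordellWeilRank = 1 →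
      Finite (AddCommGroup.primaryComponent (W.baseChange K).sha p) →
      ∀ (D : (W.baseChange K).LambdaAdicSelmerData κ γ)
        (C : Literature.NumberTheory.EllipticCurves.CastellaGrossiLeeSkinner2022.StabilizedHeegnerData
          (W.conductorNorm ℤ) W K κ jbar)
        (X : (W.baseChange K).SelmerDualData κ γ),
        Module.Finite (Literature.NumberTheory.EllipticCurves.IwasawaAlgebra p) D.S →
        Module.Finite (Literature.NumberTheory.EllipticCurves.IwasawaAlgebra p) X.X →
        Module.IsTorsion (Literature.NumberTheory.EllipticCurves.IwasawaAlgebra p)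
          (D.S ⧸ Literature.NumberTheory.EllipticCurves.CastellaGrossiLeeSkinner2022.stabilizedHeegnerModule
            D C) →
      ∀ 𝔭 : PrimeSpectrum (Literature.NumberTheory.EllipticCurves.IwasawaAlgebra p),
        𝔭.asIdeal = Ideal.span {(p : Literature.NumberTheory.EllipticCurves.IwasawaAlgebra p)} →
        Module.lengthAt (Literature.NumberTheory.EllipticCurves.IwasawaAlgebra p)
          (Submodule.torsion (Literature.NumberTheory.EllipticCurves.IwasawaAlgebra p) X.X) 𝔭 ≤
        2 * Module.lengthAt (Literature.NumberTheory.EllipticCurves.IwasawaAlgebra p)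
          (D.S ⧸ Literature.NumberTheory.EllipticCurves.CastellaGrossiLeeSkinner2022.stabilizedHeegnerModule
            D C) 𝔭) :
    BeyondCarrierDepthX10b := by
  refine stub_beyondCarrier_of_upperLink_of_namedFacts h331 hChaL hKo ?_
  intro W _ _ p _ _ K _ _ hX hns hcm hK hodd h3 hHN hHp hirr ι κ hκ γ _ Dt hc H ιC P hP hrk hfin hPinf
  by_cases hh : p ∣ NumberField.classNumber K
  · exact upperLinkX10b_divisibleClassNumber_of_muStabilized_of_printFacts hNV hCGLS hTw h57 h59gp h422 h513
      hC h331 hμC W p K hX hns hcm hK hodd h3 hHN hHp hh hirr ι κ hκ γ Dt hc H ιC P hP hrk hfin hPinf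
  · exact upperLinkX10b_coprimeClassNumber_of_pinnedPrintFacts h46 h57 h59gp h422 h513 hC h331 W p K hX hns
      hcm hK hodd h3 hHN hHp hirr hh ι κ hκ γ Dt hc H ιC P hP hrk hfin hPinf

end Summit.BirchSwinnertonDyer.BirchSwinnertonDyer.Cruxes.BeyondCarrierDepthX10b.HowardFrames

end
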